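import Summits.Ventures.Crystal3D.Theorems.StickyWulffConstantTextureLiminfFluxCount
import Summits.Ventures.Crystal3D.Theorems.StickyWulffConstantTextureLiminfChargeFlux
import Summits.Ventures.Crystal3D.Theorems.StickyWulffConstantGenericWallFloorShellCount
import HarnessLib

/-!
# The wall cell's charge is at most the two plates' zigzag line counts: `2·Q(c) ≤ #T₁ + #T₂ + C(R₀)(1+h)ρ` for every
# flux-dominated table (lane T, the T-side port of lane G's walker ledger; crux `TextureLiminf`, stmt-Ventures-19483)

HONEST FRAMING. Venture `Summits/Ventures/Crystal3D` (cell `crystal3d-full`), helper `--supports` the crux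
`TextureLiminf` (stmt-Ventures-19483) of `route-Ventures-StickyWulffConstant`, registered line `TexShadow` (v6.6; cf-p1
ROUTE.md §86(42) AK).  Rung credit only; F-C1 not moved.  NOT the wall law: what remains for the walker-covered stub is
the CAP-START walker family indexed by the line sets `T₁`, `T₂` below (one start per zigzag line, injective ends at
unsaturated balls of the window) — F4, joint with 19480-p2.

`BilayerWallAt`'s charge of a table `c` is `Q(c) = Σ'_{(i,j)} c i j · |S_ρ ∩ laySlab L₁ s₁ i ∩ laySlab L₂ s₂ j|`, `S_ρ` the unit
slice `{0 ≤ q₂ ≤ 1, q₀² + q₁² ≤ ρ²}`.  For a FLUX-DOMINATED table (`…TexShadowFluxDefs.FluxDominated`: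
`c i j ≤ ½(plateFlux₁ e₃ i + plateFlux₂ (−e₃) j)`, and `0 ≤ c`), this file bounds `2·Q(c)` by the number of zigzag lines of
the bottom plate with a site in the window `{−R₀−4 ≤ z ≤ −R₀−3} × disc ρ` plus the number of zigzag lines of the top plate
with a site in `{h+R₀+3 ≤ z ≤ h+R₀+4} × disc ρ`, up to `80(R₀+9)(1+h)ρ`:
`charge_le_flux` (`…ChargeFlux`) on the shrunken slice `S_{ρ−d}`, `d = 4h + 4R₀ + 36` (the lateral drift of the lines
between the cut and the plates), `plate_lines_ge_flux` (`…FluxCount`) for each plate, and the annulus `S_ρ ∖ S_{ρ−d}`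
charged at most `√2` per unit volume.

* `wallSlice`, `volume_wallSlice`, `plateFlux_nonneg`, `plateFlux_le_sqrt_two`, `tsum_volume_inter_laySlab₂`,
  `summable_charge`, `two_charge_le_const` — bookkeeping;
* **`cell_charge_le_lines`** — the statement above.
WHAT THIS IS NOT: not the walker family, not `hpay` of `bilayerWallAt_of_payerBound` (that needs `#T₁ + #T₂ ≤ Σ_PAY (12 − deg)`,
the walker-family ledger on these families); F-C1 not moved.
-/

noncomputable section

namespace Summit.Ventures.Crystal3D.Theorems

open MeasureTheory Set
open scoped ENNReal InnerProductSpace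
open Literature.MathematicalPhysics.StatisticalMechanics (IsHaggSeq triangularVec₁ triangularVec₂)
open Summit.Ventures.Crystal3D.Cruxes.TextureLiminf.TexShadow (E3 e₃ laySlab bilayerRise PlateLaunchable plateFlux
  FluxDominated)

/-! ## The unit slice -/

/-- The unit slice of radius `r` of the wall cell: `{0 ≤ q₂ ≤ 1, q₀² + q₁² ≤ r²}`. -/
def wallSlice (r : ℝ) : Set E3 := {q : E3 | 0 ≤ q 2 ∧ q 2 ≤ 1 ∧ q 0 ^ 2 + q 1 ^ 2 ≤ r ^ 2}

/-- As an axis-aligned cylinder. -/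
theorem wallSlice_eq_cyl (r : ℝ) : wallSlice r = {y : E3 | y 0 ^ 2 + y 1 ^ 2 ≤ r ^ 2 ∧ 0 ≤ y 2 ∧ y 2 ≤ 1} := by
  ext y; simp only [wallSlice, Set.mem_setOf_eq]; tauto

/-- The unit slice is measurable. -/
theorem measurableSet_wallSlice (r : ℝ) : MeasurableSet (wallSlice r) := by
  rw [wallSlice_eq_cyl]; exact measurableSet_cyl r 0 1

/-- Its volume is `π r²`. -/
theorem volume_wallSlice (r : ℝ) (hr : 0 ≤ r) : volume (wallSlice r) = ENNReal.ofReal (Real.pi * r ^ 2) := by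
  rw [wallSlice_eq_cyl, volume_cyl r 0 1 hr, sub_zero, ENNReal.ofReal_one, one_mul, ← ENNReal.ofReal_pow hr,
    ← ENNReal.ofReal_mul (by positivity), mul_comm]

/-- Slices are nested. -/
theorem wallSlice_mono {r r' : ℝ} (h : r' ≤ r) (hr' : 0 ≤ r') : wallSlice r' ⊆ wallSlice r := by
  rintro q ⟨h1, h2, h3⟩; exact ⟨h1, h2, h3.trans (by nlinarith)⟩

/-! ## Flux bounds and summability -/

/-- `plateFlux ≥ 0` (unit direction). -/
theorem plateFlux_nonneg (τ₀ : ℝ) (L : E3 ≃ₗᵢ[ℝ] E3) (σ : ℤ → ℤ) {e : E3} (he : ‖e‖ = 1) (i : ℤ) :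
    0 ≤ plateFlux τ₀ L σ e i := by
  classical
  unfold plateFlux
  split_ifs
  · exact mul_nonneg (Real.sqrt_nonneg _) (le_trans (by norm_num) (quarter_le_bilayerRise L σ he i))
  · exact le_rfl

/-- `plateFlux ≤ √2` (unit direction). -/
theorem plateFlux_le_sqrt_two (τ₀ : ℝ) (L : E3 ≃ₗᵢ[ℝ] E3) (σ : ℤ → ℤ) {e : E3} (he : ‖e‖ = 1) (i : ℤ) :
    plateFlux τ₀ L σ e i ≤ Real.sqrt 2 := by
  classical
  unfold plateFlux
  split_ifs
  · have := bilayerRise_le_one L σ he i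
    have h2 : 0 ≤ Real.sqrt 2 := Real.sqrt_nonneg _
    nlinarith
  · exact Real.sqrt_nonneg _

/-- Double slicing: `Σ'_{(i,j)} |X ∩ slab₁ i ∩ slab₂ j| = |X|`. -/
theorem tsum_volume_inter_laySlab₂ (L₁ L₂ : E3 ≃ₗᵢ[ℝ] E3) (s₁ s₂ : E3) (X : Set E3) (hX : MeasurableSet X) :
    ∑' ij : ℤ × ℤ, volume (X ∩ laySlab L₁ s₁ ij.1 ∩ laySlab L₂ s₂ ij.2) = volume X := by
  rw [ENNReal.tsum_prod', measure_eq_tsum_inter_laySlab L₁ s₁ X hX]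
  refine tsum_congr fun i => ?_
  exact (measure_eq_tsum_inter_laySlab L₂ s₂ (X ∩ laySlab L₁ s₁ i) (hX.inter (measurableSet_laySlab L₁ s₁ i))).symm

/-- The charge family of a bounded nonnegative table over a set of finite volume is summable. -/
theorem summable_charge (L₁ L₂ : E3 ≃ₗᵢ[ℝ] E3) (s₁ s₂ : E3) (c : ℤ → ℤ → ℝ) (B : ℝ) (hc0 : ∀ i j, 0 ≤ c i j)
    (hcB : ∀ i j, c i j ≤ B) (X : Set E3) (hX : MeasurableSet X) (hXfin : volume X ≠ ⊤) :
    Summable fun ij : ℤ × ℤ => c ij.1 ij.2 * (volume (X ∩ laySlab L₁ s₁ ij.1 ∩ laySlab L₂ s₂ ij.2)).toReal := by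
  have hB : 0 ≤ B := (hc0 0 0).trans (hcB 0 0)
  have hle : ∑' ij : ℤ × ℤ, ENNReal.ofReal (c ij.1 ij.2) * volume (X ∩ laySlab L₁ s₁ ij.1 ∩ laySlab L₂ s₂ ij.2) ≤
      ENNReal.ofReal B * volume X := by
    rw [← tsum_volume_inter_laySlab₂ L₁ L₂ s₁ s₂ X hX, ← ENNReal.tsum_mul_left]
    exact ENNReal.tsum_le_tsum fun ij => by gcongr; exact hcB _ _
  have hfin : ∑' ij : ℤ × ℤ, ENNReal.ofReal (c ij.1 ij.2) * volume (X ∩ laySlab L₁ s₁ ij.1 ∩ laySlab L₂ s₂ ij.2) ≠ ⊤ :=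
    ne_top_of_le_ne_top (ENNReal.mul_ne_top ENNReal.ofReal_ne_top hXfin) hle
  have h := ENNReal.summable_toReal hfin
  refine h.congr fun ij => ?_
  rw [ENNReal.toReal_mul, ENNReal.toReal_ofReal (hc0 _ _)]

/-- A bounded table charges at most `B` per unit volume: `2·Q_X(c) ≤ 2B·|X|`. -/
theorem two_charge_le_const (L₁ L₂ : E3 ≃ₗᵢ[ℝ] E3) (s₁ s₂ : E3) (c : ℤ → ℤ → ℝ) (B : ℝ) (hc0 : ∀ i j, 0 ≤ c i j)
    (hcB : ∀ i j, c i j ≤ B) (X : Set E3) (hX : MeasurableSet X) (hXfin : volume X ≠ ⊤) :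
    2 * ∑' ij : ℤ × ℤ, c ij.1 ij.2 * (volume (X ∩ laySlab L₁ s₁ ij.1 ∩ laySlab L₂ s₂ ij.2)).toReal ≤
      2 * B * (volume X).toReal := by
  have hB : 0 ≤ B := (hc0 0 0).trans (hcB 0 0)
  have h := charge_le_flux L₁ L₂ s₁ s₂ (fun _ => B) (fun _ => B) c B (fun _ => hB) (fun _ => le_rfl) (fun _ => hB)
    (fun _ => le_rfl) hc0 (fun i j => by linarith [hcB i j]) X hX hXfin
  have h1 : ∑' i : ℤ, B * (volume (X ∩ laySlab L₁ s₁ i)).toReal = B * (volume X).toReal := by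
    rw [tsum_mul_left, ← ENNReal.tsum_toReal_eq fun i => ne_top_of_le_ne_top hXfin (measure_mono Set.inter_subset_left),
      ← measure_eq_tsum_inter_laySlab L₁ s₁ X hX]
  have h2 : ∑' j : ℤ, B * (volume (X ∩ laySlab L₂ s₂ j)).toReal = B * (volume X).toReal := by
    rw [tsum_mul_left, ← ENNReal.tsum_toReal_eq fun j => ne_top_of_le_ne_top hXfin (measure_mono Set.inter_subset_left),
      ← measure_eq_tsum_inter_laySlab L₂ s₂ X hX]
  rw [h1, h2] at h
  linarith


/-! ## The cell bound -/

/-- `√2 ≤ 1.42` and `π < 3.15`, packaged: `4·√2·π ≤ 18`. -/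
theorem four_sqrt_two_pi_le : 4 * Real.sqrt 2 * Real.pi ≤ 18 := by
  have h2 : Real.sqrt 2 ≤ 1.42 := by
    rw [show (1.42 : ℝ) = Real.sqrt (1.42 ^ 2) by rw [Real.sqrt_sq (by norm_num)]]
    exact Real.sqrt_le_sqrt (by norm_num)
  have hπ := Real.pi_lt_d2
  nlinarith [Real.sqrt_nonneg 2, Real.pi_pos]

/-- **The wall cell's charge is at most the two plates' zigzag line counts.**  See the module docstring. -/
theorem cell_charge_le_lines {σ₁ σ₂ : ℤ → ℤ} (hσ₁ : IsHaggSeq σ₁) (hσ₂ : IsHaggSeq σ₂)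
    (L₁ L₂ : E3 ≃ₗᵢ[ℝ] E3) (s₁ s₂ : E3) (τ₀ R₀ h ρ : ℝ) (hR₀ : 1 ≤ R₀) (hh : 0 ≤ h) (hρ : 0 ≤ ρ)
    (c : ℤ → ℤ → ℝ) (hc0 : ∀ i j, 0 ≤ c i j) (hdom : FluxDominated τ₀ L₁ σ₁ L₂ σ₂ c)
    (T₁ T₂ : Finset (Fin 2 → ℤ))
    (hT₁ : ∀ t : Fin 2 → ℤ, (∃ k : ℤ,
        -R₀ - 4 ≤ (L₁ (zigVertex L₁ σ₁ e₃ k + ((t 0 : ℝ) • triangularVec₁ 1 + (t 1 : ℝ) • triangularVec₂ 1)) + s₁) 2 ∧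
        (L₁ (zigVertex L₁ σ₁ e₃ k + ((t 0 : ℝ) • triangularVec₁ 1 + (t 1 : ℝ) • triangularVec₂ 1)) + s₁) 2 ≤ -R₀ - 3 ∧
        Real.sqrt ((L₁ (zigVertex L₁ σ₁ e₃ k + ((t 0 : ℝ) • triangularVec₁ 1 + (t 1 : ℝ) • triangularVec₂ 1)) + s₁) 0 ^ 2 +
          (L₁ (zigVertex L₁ σ₁ e₃ k + ((t 0 : ℝ) • triangularVec₁ 1 + (t 1 : ℝ) • triangularVec₂ 1)) + s₁) 1 ^ 2) ≤ ρ) →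
        t ∈ T₁)
    (hT₂ : ∀ t : Fin 2 → ℤ, (∃ k : ℤ,
        h + R₀ + 3 ≤ (L₂ (zigVertex L₂ σ₂ (-e₃) k + ((t 0 : ℝ) • triangularVec₁ 1 + (t 1 : ℝ) • triangularVec₂ 1)) + s₂) 2 ∧
        (L₂ (zigVertex L₂ σ₂ (-e₃) k + ((t 0 : ℝ) • triangularVec₁ 1 + (t 1 : ℝ) • triangularVec₂ 1)) + s₂) 2 ≤ h + R₀ + 4 ∧
        Real.sqrt ((L₂ (zigVertex L₂ σ₂ (-e₃) k + ((t 0 : ℝ) • triangularVec₁ 1 + (t 1 : ℝ) • triangularVec₂ 1)) + s₂) 0 ^ 2 +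
          (L₂ (zigVertex L₂ σ₂ (-e₃) k + ((t 0 : ℝ) • triangularVec₁ 1 + (t 1 : ℝ) • triangularVec₂ 1)) + s₂) 1 ^ 2) ≤ ρ) →
        t ∈ T₂) :
    2 * ∑' ij : ℤ × ℤ, c ij.1 ij.2 * (volume (wallSlice ρ ∩ laySlab L₁ s₁ ij.1 ∩ laySlab L₂ s₂ ij.2)).toReal ≤
      (T₁.card : ℝ) + T₂.card + 80 * (R₀ + 9) * (1 + h) * ρ := by
  have he₃ : ‖(e₃ : E3)‖ = 1 := by rw [e₃, PiLp.norm_single, norm_one]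
  have hne₃ : ‖(-e₃ : E3)‖ = 1 := by rw [norm_neg, he₃]
  have hi₃ : ∀ p : E3, ⟪p, e₃⟫_ℝ = p 2 := fun p => by
    rw [e₃, EuclideanSpace.inner_single_right]; simp
  -- the table is bounded by `√2`
  have hcB : ∀ i j, c i j ≤ Real.sqrt 2 := fun i j =>
    (hdom i j).trans (by linarith [plateFlux_le_sqrt_two τ₀ L₁ σ₁ he₃ i, plateFlux_le_sqrt_two τ₀ L₂ σ₂ hne₃ j])
  have hs2 : 0 ≤ Real.sqrt 2 := Real.sqrt_nonneg 2
  have h418 := four_sqrt_two_pi_le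
  have hπ0 := Real.pi_pos.le
  set d : ℝ := 4 * h + 4 * R₀ + 36 with hd
  have hd0 : 0 ≤ d := by rw [hd]; positivity
  have hdle : d ≤ 4 * (R₀ + 9) * (1 + h) := by rw [hd]; nlinarith
  have hT0 : (0 : ℝ) ≤ (T₁.card : ℝ) + T₂.card := by positivity
  -- finiteness of slices
  have hSfin : ∀ r, 0 ≤ r → volume (wallSlice r) ≠ ⊤ := fun r hr => by rw [volume_wallSlice r hr]; exact ENNReal.ofReal_ne_top
  by_cases hsmall : ρ ≤ d
  · -- degenerate: the whole slice is rim
    have h1 := two_charge_le_const L₁ L₂ s₁ s₂ c (Real.sqrt 2) hc0 hcB (wallSlice ρ) (measurableSet_wallSlice ρ) (hSfin ρ hρ)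
    rw [volume_wallSlice ρ hρ, ENNReal.toReal_ofReal (by positivity)] at h1
    have h2 : Real.pi * ρ ^ 2 ≤ Real.pi * (ρ * d) := mul_le_mul_of_nonneg_left (by nlinarith) hπ0
    have h3 : 2 * Real.sqrt 2 * (Real.pi * (ρ * d)) ≤ 80 * (R₀ + 9) * (1 + h) * ρ := by
      have : 2 * Real.sqrt 2 * (Real.pi * (ρ * d)) = (2 * Real.sqrt 2 * Real.pi) * d * ρ := by ring
      rw [this]
      have h4 : 2 * Real.sqrt 2 * Real.pi ≤ 9 := by linarith
      have h5 : (2 * Real.sqrt 2 * Real.pi) * d ≤ 9 * (4 * (R₀ + 9) * (1 + h)) :=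
        mul_le_mul h4 hdle hd0 (by norm_num)
      nlinarith
    nlinarith [mul_le_mul_of_nonneg_left h2 (by positivity : 0 ≤ 2 * Real.sqrt 2)]
  -- the shrunken slice and the annulus
  push Not at hsmall
  set ρ' : ℝ := ρ - d with hρ'
  have hρ'0 : 0 ≤ ρ' := by rw [hρ']; linarith
  have hρ'ρ : ρ' ≤ ρ := by rw [hρ']; linarith
  set S : Set E3 := wallSlice ρ with hS
  set S' : Set E3 := wallSlice ρ' with hS'
  set ann : Set E3 := S \ S' with hann
  have hS'S : S' ⊆ S := wallSlice_mono hρ'ρ hρ'0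
  have hSm : MeasurableSet S := measurableSet_wallSlice ρ
  have hS'm : MeasurableSet S' := measurableSet_wallSlice ρ'
  have hannm : MeasurableSet ann := hSm.diff hS'm
  have hannfin : volume ann ≠ ⊤ := ne_top_of_le_ne_top (hSfin ρ hρ) (measure_mono Set.sdiff_subset)
  -- split the charge
  set f : Set E3 → ℤ × ℤ → ℝ := fun X ij => c ij.1 ij.2 * (volume (X ∩ laySlab L₁ s₁ ij.1 ∩ laySlab L₂ s₂ ij.2)).toReal with hf
  have hsplit : ∀ ij, f S ij = f S' ij + f ann ij := by
    intro ij
    simp only [hf]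
    have hset : S ∩ laySlab L₁ s₁ ij.1 ∩ laySlab L₂ s₂ ij.2 =
        (S' ∩ laySlab L₁ s₁ ij.1 ∩ laySlab L₂ s₂ ij.2) ∪ (ann ∩ laySlab L₁ s₁ ij.1 ∩ laySlab L₂ s₂ ij.2) := by
      rw [← Set.union_inter_distrib_right, ← Set.union_inter_distrib_right, hann, Set.union_sdiff_cancel hS'S]
    have hdisj : Disjoint (S' ∩ laySlab L₁ s₁ ij.1 ∩ laySlab L₂ s₂ ij.2) (ann ∩ laySlab L₁ s₁ ij.1 ∩ laySlab L₂ s₂ ij.2) :=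
      (Set.disjoint_sdiff_right).mono (Set.inter_subset_left.trans Set.inter_subset_left)
        (Set.inter_subset_left.trans Set.inter_subset_left)
    rw [hset, measure_union hdisj ((hannm.inter (measurableSet_laySlab L₁ s₁ _)).inter (measurableSet_laySlab L₂ s₂ _)),
      ENNReal.toReal_add (ne_top_of_le_ne_top (hSfin ρ' hρ'0) (measure_mono (Set.inter_subset_left.trans Set.inter_subset_left)))
        (ne_top_of_le_ne_top hannfin (measure_mono (Set.inter_subset_left.trans Set.inter_subset_left))), mul_add]
  have hsumS' := summable_charge L₁ L₂ s₁ s₂ c (Real.sqrt 2) hc0 hcB S' hS'm (hSfin ρ' hρ'0)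
  have hsumA := summable_charge L₁ L₂ s₁ s₂ c (Real.sqrt 2) hc0 hcB ann hannm hannfin
  have hQ : ∑' ij, f S ij = ∑' ij, f S' ij + ∑' ij, f ann ij := by
    rw [← hsumS'.tsum_add hsumA]; exact tsum_congr hsplit
  -- the shrunken slice: flux
  have hdomκ : ∀ i j, c i j ≤ (plateFlux τ₀ L₁ σ₁ e₃ i + plateFlux τ₀ L₂ σ₂ (-e₃) j) / 2 := hdom
  have hflux := charge_le_flux L₁ L₂ s₁ s₂ (plateFlux τ₀ L₁ σ₁ e₃) (plateFlux τ₀ L₂ σ₂ (-e₃)) c (Real.sqrt 2)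
    (plateFlux_nonneg τ₀ L₁ σ₁ he₃) (plateFlux_le_sqrt_two τ₀ L₁ σ₁ he₃) (plateFlux_nonneg τ₀ L₂ σ₂ hne₃)
    (plateFlux_le_sqrt_two τ₀ L₂ σ₂ hne₃) hc0 hdomκ S' hS'm (hSfin ρ' hρ'0)
  -- plate 1
  have hS'sub₁ : S' ⊆ {p : E3 | (0 : ℝ) ≤ ⟪p, e₃⟫_ℝ ∧ ⟪p, e₃⟫_ℝ ≤ 0 + 1 ∧ Real.sqrt (p 0 ^ 2 + p 1 ^ 2) ≤ ρ'} := by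
    rintro p ⟨h1, h2, h3⟩
    refine ⟨by rw [hi₃]; exact h1, by rw [hi₃]; linarith, ?_⟩
    rw [← Real.sqrt_sq hρ'0]; exact Real.sqrt_le_sqrt h3
  have hP₁ := plate_lines_ge_flux hσ₁ L₁ s₁ e₃ he₃ τ₀ ρ' 0 (-R₀ - 4) (by linarith) S' hS'm (hSfin ρ' hρ'0) hS'sub₁ T₁
    (fun t ⟨k, hk1, hk2, hk3⟩ => hT₁ t ⟨k, by rw [hi₃] at hk1; linarith, by rw [hi₃] at hk2; linarith,
      hk3.trans (by rw [hρ', hd]; linarith)⟩)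
  -- plate 2
  have hS'sub₂ : S' ⊆ {p : E3 | (-1 : ℝ) ≤ ⟪p, -e₃⟫_ℝ ∧ ⟪p, -e₃⟫_ℝ ≤ -1 + 1 ∧ Real.sqrt (p 0 ^ 2 + p 1 ^ 2) ≤ ρ'} := by
    rintro p ⟨h1, h2, h3⟩
    refine ⟨by rw [inner_neg_right, hi₃]; linarith, by rw [inner_neg_right, hi₃]; linarith, ?_⟩
    rw [← Real.sqrt_sq hρ'0]; exact Real.sqrt_le_sqrt h3
  have hP₂ := plate_lines_ge_flux hσ₂ L₂ s₂ (-e₃) hne₃ τ₀ ρ' (-1) (-h - R₀ - 4) (by linarith) S' hS'm (hSfin ρ' hρ'0)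
    hS'sub₂ T₂ (fun t ⟨k, hk1, hk2, hk3⟩ => hT₂ t ⟨k, by rw [inner_neg_right, hi₃] at hk2; linarith,
      by rw [inner_neg_right, hi₃] at hk1; linarith, hk3.trans (by rw [hρ', hd]; linarith)⟩)
  -- the annulus
  have hA := two_charge_le_const L₁ L₂ s₁ s₂ c (Real.sqrt 2) hc0 hcB ann hannm hannfin
  have hvolann : (volume ann).toReal = Real.pi * ρ ^ 2 - Real.pi * ρ' ^ 2 := by
    have hu : volume S = volume S' + volume ann := by
      rw [← measure_union (Set.disjoint_sdiff_right) hannm, Set.union_sdiff_cancel hS'S]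
    rw [hS, hS', volume_wallSlice ρ hρ, volume_wallSlice ρ' hρ'0] at hu
    have h1 : volume ann = ENNReal.ofReal (Real.pi * ρ ^ 2) - ENNReal.ofReal (Real.pi * ρ' ^ 2) :=
      (ENNReal.sub_eq_of_eq_add_rev ENNReal.ofReal_ne_top hu).symm
    rw [h1, ← ENNReal.ofReal_sub _ (by positivity), ENNReal.toReal_ofReal]
    nlinarith [mul_le_mul_of_nonneg_left (pow_le_pow_left₀ hρ'0 hρ'ρ 2) hπ0]
  have hannle : (volume ann).toReal ≤ 2 * Real.pi * ρ * d := by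
    rw [hvolann, hρ']; nlinarith [mul_nonneg hπ0 (sq_nonneg d)]
  -- assemble
  have hmain : 2 * ∑' ij, f S ij ≤ (T₁.card : ℝ) + T₂.card + 2 * Real.sqrt 2 * (2 * Real.pi * ρ * d) := by
    rw [hQ, mul_add]
    have h1 : 2 * ∑' ij, f S' ij ≤ (T₁.card : ℝ) + T₂.card := by
      simp only [hf] at hflux ⊢; linarith
    have h2 : 2 * ∑' ij, f ann ij ≤ 2 * Real.sqrt 2 * (2 * Real.pi * ρ * d) := by
      simp only [hf] at hA ⊢
      exact hA.trans (mul_le_mul_of_nonneg_left hannle (by positivity))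
    linarith
  have hconst : 2 * Real.sqrt 2 * (2 * Real.pi * ρ * d) ≤ 80 * (R₀ + 9) * (1 + h) * ρ := by
    have : 2 * Real.sqrt 2 * (2 * Real.pi * ρ * d) = (4 * Real.sqrt 2 * Real.pi) * d * ρ := by ring
    rw [this]
    have h5 : (4 * Real.sqrt 2 * Real.pi) * d ≤ 18 * (4 * (R₀ + 9) * (1 + h)) := mul_le_mul h418 hdle hd0 (by norm_num)
    nlinarith
  simp only [hf] at hmain
  linarith

end Summit.Ventures.Crystal3D.Theorems

end
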